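import Literature.AnabelianGeometry.EtaleTheta.Discharge.Sec1DeltaEllExtensionOfClosure
import HarnessLib

/-!
# [EtTh] §1 p. 12 «1 → Ẑ(1) → Δ^ell_X → Ẑ → 1»: the FACT-LIST reduction
# `DeltaYEllClosureIsoTate ⟸ DeltaEllExtension` (F-1697 ⟸ F-0657) — the `Ẑ(1)` of the typed extension IS
# the closure of the image of `Δ^tp_Y`

Mochizuki, *The étale theta function and its Frobenioid-theoretic manifestations*, Publ. RIMS **45** (2009)
[EtTh], §1, PRIMS PDF p. 12 (printed 238): "Then we have a natural exact sequence `1 → Ẑ(1) → Δ^ell_X → Ẑ → 1`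
… Thus, `(Δ^tp_Y)^ell ≅ Ẑ(1)`" [cite: MochizukiEtTh2009, §1 p.12].  abc-iut cell, block C / F = FACT-PROVING
WAVE, seat abc-iut-f-172 (gen 2), tranche 172 (F-0658 · F-0659 · F-1697); PROOF-ONLY (no `def`, no `instance`,
no named fact); a read-only consumer of abc-iut-L3's frozen `SemiGraphs/TemperedCyclotomic.lean`
(`OncePuncturedTemperedGroup.DeltaEllExtension` = FACT-LIST F-0657, `DeltaYEllClosureIsoTate` = F-1697) and of
abc-iut-L2-t7's `Sec1DeltaEllExtensionOfClosure.lean` (`DeltaEllZHat.exists_deltaEll_hom_zHat`, the converse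
edge F-0657 ⟸ F-1697); nothing of either is edited or restated.

WHAT IS PROVED, for EVERY `D : OncePuncturedTemperedGroup K` (no origin binder):
* `DeltaEllZHat.dense_range_delta_deltaEll` — the image of `Δ^tp_X` in `Δ^ell_X = Δ_X/[Δ_X,Δ_X]⁻` is DENSE
  (`Δ_X` is the closure of the image of `Δ^tp_X`, and `Δ_X ↠ Δ^ell_X` is a continuous surjection);
* `DeltaEllZHat.eq_top_of_isClosed_of_forall_delta_mem` — a closed subgroup of `Δ^ell_X` containing the image
  of `Δ^tp_X` is everything;
* `DeltaEllZHat.level_family_eq_level_comp` — UNIQUENESS OF THE `Ẑ`-QUOTIENT: any family of level characters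
  `λ_n : Δ^ell_X → ℤ/n` with open kernels and the printed values `λ_n(δ) = zQuot(δ) mod n` on `Δ^tp_X` (the
  clauses of `DeltaEllExtension`) coincides with `level_n ∘ Λ̄` for the canonical `Λ̄ : Δ^ell_X ↠ Ẑ` of
  `exists_deltaEll_hom_zHat` (two continuous characters agreeing on a dense subgroup: their equaliser is an
  open, hence closed, subgroup containing the image of `Δ^tp_X`);
and, for every origin binder `Ω`,
* `DeltaEllZHat.deltaYEllClosureIsoTate_of_deltaEllExtension` — **F-1697 ⟸ F-0657**: the subgroup `T ≤ Δ^ell_X`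
  that `DeltaEllExtension Ω` provides (`T = ⋂_n Ker λ_n` by its clauses) equals `Ker Λ̄`, whose carrier is the
  closure of the image of `Δ^tp_Y`; so `T` with its Tate-twist datum witnesses `DeltaYEllClosureIsoTate Ω`.
Together with abc-iut-L2-t7's `deltaEllExtension_of_deltaYEllClosureIsoTate` (p432133) the two typed facts
F-0657 and F-1697 are EQUIVALENT in the kernel (`deltaEllExtension_iff_deltaYEllClosureIsoTate`).

HONEST FRAMING: [EtTh] is refereed; the L3 interface is DATA quoting print, asserted for no curve; this file
relates two of OUR typed predicates and proves neither (their universal closures are refuted as schemas over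
the lawless origin binder, `TemperedCyclotomicClosures.lean`); nothing here bears on [IUTchIII] Cor. 3.12;
typed ≠ proved; no side is taken on any disputed claim.
-/

noncomputable section

namespace Literature.AnabelianGeometry.EtaleTheta

open Literature.AnabelianGeometry.SemiGraphs
open _root_.Topology

namespace DeltaEllZHat

universe u

variable {K : Type u} [Field K] (D : OncePuncturedTemperedGroup K)

/-- **The image of `Δ^tp_X` in `Δ^ell_X` is dense** ([EtTh] p. 12: `Δ_X := (Δ^tp_X)^∧` is the closure of the
image of `Δ^tp_X` in `Π_X`, and `Δ_X ↠ Δ^ell_X = Δ_X/[Δ_X,Δ_X]⁻` is a continuous surjection).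
[cite: MochizukiEtTh2009, §1 p.12] -/
theorem dense_range_delta_deltaEll :
    Dense (Set.range fun δ : D.delta =>
      (QuotientGroup.mk ⟨D.toHat δ, Subgroup.le_topologicalClosure _ ⟨δ, δ.2, rfl⟩⟩ : D.DeltaEll)) := by
  -- density of the image of `Δ^tp_X` inside the subspace `Δ_X` of `Π_X`
  let S₀ : Set ↥D.deltaHat := {w | (w : D.PiHat) ∈ (D.delta.map D.toHat.toMonoidHom : Set D.PiHat)}
  have hind : Topology.IsInducing (fun w : ↥D.deltaHat => (w : D.PiHat)) := Topology.IsInducing.subtypeVal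
  have himg : (fun w : ↥D.deltaHat => (w : D.PiHat)) '' S₀ = (D.delta.map D.toHat.toMonoidHom : Set D.PiHat) := by
    ext y
    constructor
    · rintro ⟨w, hw, rfl⟩
      exact hw
    · intro hy
      exact ⟨⟨y, Subgroup.le_topologicalClosure _ hy⟩, hy, rfl⟩
  have hS₀ : Dense S₀ := by
    rw [hind.dense_iff]
    intro x
    rw [himg, ← Subgroup.topologicalClosure_coe]
    exact x.2
  -- push forward along the continuous surjection `Δ_X ↠ Δ^ell_X`
  have hmk : DenseRange (QuotientGroup.mk : ↥D.deltaHat → D.DeltaEll) :=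
    QuotientGroup.mk_surjective.denseRange
  have h2 : Dense ((QuotientGroup.mk : ↥D.deltaHat → D.DeltaEll) '' S₀) :=
    hmk.dense_image QuotientGroup.continuous_mk hS₀
  refine h2.mono ?_
  rintro _ ⟨w, ⟨δ, hδ, hw⟩, rfl⟩
  refine ⟨⟨δ, hδ⟩, ?_⟩
  show (QuotientGroup.mk _ : D.DeltaEll) = QuotientGroup.mk w
  congr 1
  exact Subtype.ext hw

/-- A CLOSED subgroup of `Δ^ell_X` containing the image of `Δ^tp_X` is all of `Δ^ell_X` (density,
`dense_range_delta_deltaEll`). [cite: MochizukiEtTh2009, §1 p.12] -/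
theorem eq_top_of_isClosed_of_forall_delta_mem (H : Subgroup D.DeltaEll) (hH : IsClosed (H : Set D.DeltaEll))
    (hmem : ∀ δ : D.delta,
      (QuotientGroup.mk ⟨D.toHat δ, Subgroup.le_topologicalClosure _ ⟨δ, δ.2, rfl⟩⟩ : D.DeltaEll) ∈ H) :
    H = ⊤ := by
  rw [eq_top_iff]
  intro x _
  have hsub : (Set.range fun δ : D.delta =>
      (QuotientGroup.mk ⟨D.toHat δ, Subgroup.le_topologicalClosure _ ⟨δ, δ.2, rfl⟩⟩ : D.DeltaEll)) ⊆ H := by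
    rintro _ ⟨δ, rfl⟩
    exact hmem δ
  have hx : x ∈ closure (Set.range fun δ : D.delta =>
      (QuotientGroup.mk ⟨D.toHat δ, Subgroup.le_topologicalClosure _ ⟨δ, δ.2, rfl⟩⟩ : D.DeltaEll)) := by
    rw [(dense_range_delta_deltaEll D).closure_eq]
    exact Set.mem_univ x
  exact hH.closure_subset_iff.2 hsub hx

/-- **Uniqueness of the `Ẑ`-quotient of `Δ^ell_X`** ([EtTh] p. 12, the `→ Ẑ → 1` half of the display): a
family of level characters `λ_n : Δ^ell_X → ℤ/n` (`n ≥ 1`) with OPEN kernels and the printed values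
`λ_n(δ) = zQuot(δ) mod n` on the image of `Δ^tp_X` — the clauses of the typed fact `DeltaEllExtension` —
coincides, at every positive level, with `level_n ∘ Λ̄` for the canonical continuous surjection
`Λ̄ : Δ^ell_X ↠ Ẑ` of `exists_deltaEll_hom_zHat` (any `Λ̄` with the printed values on `Δ^tp_X`): the equaliser
of the two characters is an open, hence closed, subgroup containing the dense image of `Δ^tp_X`.
[cite: MochizukiEtTh2009, §1 p.12] -/
theorem level_family_eq_level_comp (lam : ∀ n : ℕ, D.DeltaEll →* Multiplicative (ZMod n))
    (hopen : ∀ n, 0 < n → IsOpen ((lam n).ker : Set D.DeltaEll))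
    (hval : ∀ n, 0 < n → ∀ δ : D.delta,
      lam n (QuotientGroup.mk ⟨D.toHat δ, Subgroup.le_topologicalClosure _ ⟨δ, δ.2, rfl⟩⟩) =
        Multiplicative.ofAdd ((Multiplicative.toAdd (D.zQuot δ) : ℤ) : ZMod n))
    (Λ : D.DeltaEll →* ZHat) (hΛc : Continuous Λ)
    (hΛδ : ∀ δ : D.delta,
      Λ (QuotientGroup.mk ⟨D.toHat δ, Subgroup.le_topologicalClosure _ ⟨δ, δ.2, rfl⟩⟩) =
        ZHatLevel.eta (Multiplicative.toAdd (D.zQuot δ)))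
    (N : ℕ+) (x : D.DeltaEll) : lam N x = ZHatLevel.level N (Λ x) := by
  -- the equaliser subgroup
  let E : Subgroup D.DeltaEll := (lam N).eqLocus ((ZHatLevel.level N).comp Λ)
  have hle : (lam N).ker ⊓ ((ZHatLevel.level N).comp Λ).ker ≤ E := by
    intro y hy
    rw [Subgroup.mem_inf, MonoidHom.mem_ker, MonoidHom.mem_ker] at hy
    show lam N y = ((ZHatLevel.level N).comp Λ) y
    rw [hy.1, hy.2]
  have hker2 : IsOpen ((((ZHatLevel.level N).comp Λ).ker : Subgroup D.DeltaEll) : Set D.DeltaEll) := by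
    rw [← MonoidHom.comap_ker, Subgroup.coe_comap]
    exact (ZHatLevel.isOpen_ker_level N).preimage hΛc
  have hEopen : IsOpen (E : Set D.DeltaEll) := by
    refine Subgroup.isOpen_mono hle ?_
    rw [Subgroup.coe_inf]
    exact (hopen N N.pos).inter hker2
  have hEtop : E = ⊤ :=
    eq_top_of_isClosed_of_forall_delta_mem D E (Subgroup.isClosed_of_isOpen E hEopen) fun δ => by
      show lam N _ = ((ZHatLevel.level N).comp Λ) _
      rw [MonoidHom.comp_apply, hval N N.pos δ, hΛδ δ, ZHatLevel.level_eta]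
  have hx : x ∈ E := by
    rw [hEtop]
    exact Subgroup.mem_top x
  exact hx

/-- **FACT-LIST reduction F-1697 ⟸ F-0657** ([EtTh] §1 p. 12): for every origin binder `Ω`, if
"`1 → Ẑ(1) → Δ^ell_X → Ẑ → 1`" holds in its typed form (`DeltaEllExtension Ω`, F-0657), then the closure of
the image of `Δ^tp_Y` in `Δ^ell_X` is a closed `Π^tp_X`-stable Tate twist (`DeltaYEllClosureIsoTate Ω`,
F-1697): the subgroup `T = ⋂_n Ker λ_n` of F-0657 IS `Ker Λ̄` (`level_family_eq_level_comp`), whose carrier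
is that closure (`exists_deltaEll_hom_zHat`). [cite: MochizukiEtTh2009, §1 p.12] -/
theorem deltaYEllClosureIsoTate_of_deltaEllExtension (Ω : TemperedPiOrigin K)
    (h : OncePuncturedTemperedGroup.DeltaEllExtension Ω) :
    OncePuncturedTemperedGroup.DeltaYEllClosureIsoTate Ω := by
  classical
  intro D hD
  obtain ⟨T, hT, hTc, hTate, -, lam, -, hopen, hTle, -, hinj, hval⟩ := h D hD
  obtain ⟨Λ, hΛc, -, -, hΛker, hΛδ⟩ := exists_deltaEll_hom_zHat D
  refine ⟨T, hT, hTc, hTate, ?_⟩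
  rw [← hΛker]
  have hagree : ∀ (N : ℕ+) (x : D.DeltaEll), lam N x = ZHatLevel.level N (Λ x) :=
    level_family_eq_level_comp D lam hopen hval Λ hΛc hΛδ
  ext x
  rw [SetLike.mem_coe, SetLike.mem_coe, MonoidHom.mem_ker]
  constructor
  · intro hx
    refine ZHatLevel.ext_of_level fun N => ?_
    rw [← hagree N x, map_one]
    exact hTle N N.pos hx
  · intro hx
    refine hinj x fun n hn => ?_
    obtain ⟨N, rfl⟩ : ∃ N : ℕ+, (N : ℕ) = n := ⟨Nat.toPNat n hn, rfl⟩
    rw [hagree N x, hx, map_one]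

/-- **F-0657 ⟺ F-1697 in the kernel** ([EtTh] §1 p. 12): for every origin binder `Ω`, the typed
"`1 → Ẑ(1) → Δ^ell_X → Ẑ → 1`" (`DeltaEllExtension Ω`) and "the closure of the image of `Δ^tp_Y` in `Δ^ell_X`
is a `Π^tp_X`-stable Tate twist" (`DeltaYEllClosureIsoTate Ω`) are equivalent — this file's edge and
abc-iut-L2-t7's `deltaEllExtension_of_deltaYEllClosureIsoTate`. [cite: MochizukiEtTh2009, §1 p.12] -/
theorem deltaEllExtension_iff_deltaYEllClosureIsoTate (Ω : TemperedPiOrigin K) :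
    OncePuncturedTemperedGroup.DeltaEllExtension Ω ↔ OncePuncturedTemperedGroup.DeltaYEllClosureIsoTate Ω :=
  ⟨deltaYEllClosureIsoTate_of_deltaEllExtension Ω, deltaEllExtension_of_deltaYEllClosureIsoTate Ω⟩

end DeltaEllZHat

end Literature.AnabelianGeometry.EtaleTheta

end
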